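import Summits.ValiantsHypothesis.ValiantsHypothesis.Theorems.LacunarySymmetroidMatrixDescartesGraftBorderLaw
import Summits.ValiantsHypothesis.ValiantsHypothesis.Theorems.LacunarySymmetroidMatrixDescartesCensusSupportNormalForm

/-!
# `MatrixDescartes` census — THE BORDERING LAW for every support: `ζ(m+1, K+1) ≥ ζ_alt(m, K+1) + K`

HONEST FRAMING.  Object-search cell `pub-symmetroid`, crux `Theses.LacunarySymmetroid.MatrixDescartes`
(stmt-ValiantsHypothesis-18050); seat val-sym-mdr-p1 (g3).  LOWER-bound / construction mathematics in census (CONJECTURE-A) currency;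
nothing about the crux `MatrixDescartes` (an upper bound at fat formats), `DoorA26` / `DoorA34`, or `VP ≠ VNP`.  No definitions.

The seat's BORDERING LAW (`…GraftBorderLaw.lean`) asks for a STRICTLY INCREASING support; the tree's support normal form
(`Census.exists_strictMono_pencil`: `∑ X^(d l) • S l = X^e • ∑ X^(d' j) • S' j`, `d'` strictly increasing, the letters of one exponent collected,
zero letters on padding exponents) moves ANY alternation certificate to a strictly increasing support of the same length without changing
the signs of the evaluated determinants at positive points (`exists_alternating_strictMono`).  Hence for EVERY certificate with `K+1` letters:
one more row/column buys `K` more alternations (`exists_alternating_border_any`), `i` more buy `i·K` (`exists_alternating_border_any_add`) —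
the census table is monotone in `m` with gain `#letters − 1` in alternation currency.  [folklore]
-/

-- `Summit.ValiantsHypothesis.ValiantsHypothesis.…` repeats a component by the D-0017 layout
-- (single-conjunct summit), which the `dupNamespace` linter flags; the name is mandated.
set_option linter.dupNamespace false

namespace Summit.ValiantsHypothesis.ValiantsHypothesis.Theorems.LacunarySymmetroidMatrixDescartes.Census.Graft

open Matrix Finset Filter Topology
open scoped BigOperators

/-- **Support normalisation of an alternation certificate**: the same alternation data on a strictly increasing support of the same
length (`Census.exists_strictMono_pencil`; at `t > 0` the determinants differ by the positive factor `t^(e·m)`). [folklore] -/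
theorem exists_alternating_strictMono {m K N : ℕ} (d : Fin (K + 1) → ℕ) (S : Fin (K + 1) → Matrix (Fin m) (Fin m) ℝ)
    (hS : ∀ l, (S l).IsSymm) (τ : Fin (N + 1) → ℝ) (hpos : ∀ j, 0 < τ j)
    (hne : ∀ j, (∑ l, τ j ^ d l • S l).det ≠ 0)
    (halt : ∀ j : Fin N, (∑ l, τ j.castSucc ^ d l • S l).det * (∑ l, τ j.succ ^ d l • S l).det < 0) :
    ∃ (d' : Fin (K + 1) → ℕ) (S' : Fin (K + 1) → Matrix (Fin m) (Fin m) ℝ), StrictMono d' ∧ (∀ l, (S' l).IsSymm) ∧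
      (∀ j, (∑ l, τ j ^ d' l • S' l).det ≠ 0) ∧
      ∀ j : Fin N, (∑ l, τ j.castSucc ^ d' l • S' l).det * (∑ l, τ j.succ ^ d' l • S' l).det < 0 := by
  obtain ⟨e, d', S', hd', -, hsub, hid⟩ := exists_strictMono_pencil d S
  have hS' : ∀ j, (S' j).IsSymm := fun j => by
    obtain ⟨s, hs⟩ := hsub j
    rw [hs]
    exact isSymm_sum s S fun l _ => hS l
  have hdet : ∀ t : ℝ, (∑ l, t ^ d l • S l).det = t ^ (e * m) * (∑ l, t ^ d' l • S' l).det := by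
    intro t
    rw [← eval_det_pencil_eq d S t, hid, Matrix.det_smul, Fintype.card_fin, Polynomial.eval_mul, Polynomial.eval_pow,
      Polynomial.eval_pow, Polynomial.eval_X, eval_det_pencil_eq d' S' t, pow_mul]
  refine ⟨d', S', hd', hS', fun j h0 => hne j ?_, fun j => ?_⟩
  · rw [hdet, h0, mul_zero]
  · have h := halt j
    rw [hdet, hdet] at h
    have h1 : 0 < τ j.castSucc ^ (e * m) := pow_pos (hpos _) _
    have h2 : 0 < τ j.succ ^ (e * m) := pow_pos (hpos _) _
    have : τ j.castSucc ^ (e * m) * (∑ l, τ j.castSucc ^ d' l • S' l).det *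
        (τ j.succ ^ (e * m) * (∑ l, τ j.succ ^ d' l • S' l).det)
        = (τ j.castSucc ^ (e * m) * τ j.succ ^ (e * m)) *
          ((∑ l, τ j.castSucc ^ d' l • S' l).det * (∑ l, τ j.succ ^ d' l • S' l).det) := by ring
    rw [this] at h
    by_contra hge
    have hge' : 0 ≤ (∑ l, τ j.castSucc ^ d' l • S' l).det * (∑ l, τ j.succ ^ d' l • S' l).det := not_lt.mp hge
    have := mul_nonneg (mul_pos h1 h2).le hge'
    linarith

/-- **THE BORDERING LAW for every support**: any certificate `(m, K+1 letters, N)` ⇒ a certificate `(m+1, K+1 letters, N+K)` (the support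
moves to its strictly increasing normal form). [folklore] -/
theorem exists_alternating_border_any {m K N : ℕ} (d : Fin (K + 1) → ℕ)
    (S : Fin (K + 1) → Matrix (Fin m) (Fin m) ℝ) (hS : ∀ l, (S l).IsSymm)
    (τ : Fin (N + 1) → ℝ) (hτ : StrictMono τ) (hpos : ∀ j, 0 < τ j)
    (hne : ∀ j, (∑ l, τ j ^ d l • S l).det ≠ 0)
    (halt : ∀ j : Fin N, (∑ l, τ j.castSucc ^ d l • S l).det * (∑ l, τ j.succ ^ d l • S l).det < 0) :
    ∃ (d' : Fin (K + 1) → ℕ) (S' : Fin (K + 1) → Matrix (Fin (m + 1)) (Fin (m + 1)) ℝ) (τ' : Fin (N + K + 1) → ℝ),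
      StrictMono d' ∧ (∀ l, (S' l).IsSymm) ∧ StrictMono τ' ∧ (∀ j, 0 < τ' j) ∧
      (∀ j, (∑ l, τ' j ^ d' l • S' l).det ≠ 0) ∧
      ∀ j : Fin (N + K), (∑ l, τ' j.castSucc ^ d' l • S' l).det * (∑ l, τ' j.succ ^ d' l • S' l).det < 0 := by
  obtain ⟨d', S₁, hd', hS₁, hne₁, halt₁⟩ := exists_alternating_strictMono d S hS τ hpos hne halt
  obtain ⟨S', τ', hS', hτ', hpos', hne', halt'⟩ := exists_alternating_border d' hd' S₁ hS₁ τ hτ hpos hne₁ halt₁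
  exact ⟨d', S', τ', hd', hS', hτ', hpos', hne', halt'⟩

/-- **THE BORDERING LAW for every support, iterated**: any certificate `(m, K+1 letters, N)` ⇒ certificates `(m+i, K+1 letters, N+i·K)`
for every `i` — `ζ(m+i, K+1) ≥ ζ_alt(m, K+1) + i·K`. [folklore] -/
theorem exists_alternating_border_any_add {m K N : ℕ} (d : Fin (K + 1) → ℕ)
    (S : Fin (K + 1) → Matrix (Fin m) (Fin m) ℝ) (hS : ∀ l, (S l).IsSymm)
    (τ : Fin (N + 1) → ℝ) (hτ : StrictMono τ) (hpos : ∀ j, 0 < τ j)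
    (hne : ∀ j, (∑ l, τ j ^ d l • S l).det ≠ 0)
    (halt : ∀ j : Fin N, (∑ l, τ j.castSucc ^ d l • S l).det * (∑ l, τ j.succ ^ d l • S l).det < 0) (i : ℕ) :
    ∃ (d' : Fin (K + 1) → ℕ) (S' : Fin (K + 1) → Matrix (Fin (m + i)) (Fin (m + i)) ℝ) (τ' : Fin (N + i * K + 1) → ℝ),
      StrictMono d' ∧ (∀ l, (S' l).IsSymm) ∧ StrictMono τ' ∧ (∀ j, 0 < τ' j) ∧
      (∀ j, (∑ l, τ' j ^ d' l • S' l).det ≠ 0) ∧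
      ∀ j : Fin (N + i * K), (∑ l, τ' j.castSucc ^ d' l • S' l).det * (∑ l, τ' j.succ ^ d' l • S' l).det < 0 := by
  obtain ⟨d', S₁, hd', hS₁, hne₁, halt₁⟩ := exists_alternating_strictMono d S hS τ hpos hne halt
  obtain ⟨S', τ', hS', hτ', hpos', hne', halt'⟩ :=
    exists_alternating_border_add d' hd' ⟨S₁, τ, hS₁, hτ, hpos, hne₁, halt₁⟩ i
  exact ⟨d', S', τ', hd', hS', hτ', hpos', hne', halt'⟩

open Summit.ValiantsHypothesis.ValiantsHypothesis.Theorems.MatrixDescartes.Negative (PosRootLawAt)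

/-- **Row form**: any certificate with `K+1` letters and `N ≥ 1` alternations at size `m` refutes, `i` sizes down the column, the row
`PosRootLawAt (m+i) (K+1) (N + i·K − 1)`. [folklore] -/
theorem not_posRootLawAt_border {m K N : ℕ} (hN : 1 ≤ N) (d : Fin (K + 1) → ℕ)
    (S : Fin (K + 1) → Matrix (Fin m) (Fin m) ℝ) (hS : ∀ l, (S l).IsSymm)
    (τ : Fin (N + 1) → ℝ) (hτ : StrictMono τ) (hpos : ∀ j, 0 < τ j)
    (halt : ∀ j : Fin N, (∑ l, τ j.castSucc ^ d l • S l).det * (∑ l, τ j.succ ^ d l • S l).det < 0) (i : ℕ) :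
    ¬ PosRootLawAt (m + i) (K + 1) (N + i * K - 1) := by
  have hne : ∀ j, (∑ l, τ j ^ d l • S l).det ≠ 0 :=
    ne_zero_of_alternating hN (fun j => (∑ l, τ j ^ d l • S l).det) halt
  obtain ⟨d', S', τ', -, hS', hτ', hpos', -, halt'⟩ := exists_alternating_border_any_add d S hS τ hτ hpos hne halt i
  exact not_posRootLawAt_of_alternating (hN.trans (Nat.le_add_right N (i * K))) d' S' hS' τ' hτ' hpos' halt'

end Summit.ValiantsHypothesis.ValiantsHypothesis.Theorems.LacunarySymmetroidMatrixDescartes.Census.Graft
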